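/-
Copyright (c) 2026 the pub-hodgecm-mathlib formalisation cell (harness21).  Prover seat hodgecm-mathlib-K2E1-p08 (g6), Track B ∕ K2-LIT (build stream 29), h413 =
`stmt-HodgeConjecture-24833`, campaign «EIS-R7-BL-SPH-2∕3»; dealer K2E1-plan (g6) DEAL 2026-09-04T10:03:30Z (38b) «B–L BY-PRODUCTS», rulings (33), (45a).
-/
import Summits.HodgeConjecture.HodgeConjecture.Theorems.K2E1BLMeromorphicFamilyByproductsU   -- ★ (this seat) generic half: `exists_solution_byproducts`, NF gluing, `exists_global_pole_set` (brings ★ P8 §2 and its imports)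
import HarnessLib

/-!
# h413 ∕ Track B «K2-LIT», «EIS-R7-BL-SPH-2∕3» — helper `K2E1BLXSystemByproductsU` (RANK-GENERIC): THE BY-PRODUCTS (E1)–(E3) OF THE BERNSTEIN–LAPID CONSTRUCTION ON ONE BALL —
# the `g`-free vector solution `(vX, cc)` of the `𝔛`-system, holomorphic on an open dense co-discrete `U`, and the scalar pieces with non-negative order on `U`

Cell `pub/hodgecm-mathlib`, crux H413 = `stmt-HodgeConjecture-24833`, route `HCCMUnconditional`; dealer K2E1-plan (g6) RULINGS (33)∕(38b)∕(45a).  THEOREMS ONLY (no `def`∕`instance`∕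
`notation`∕named-fact hypothesis∕`sorry`); lane `--kind proof --supports stmt-HodgeConjecture-24833 --as helper` (count-neutral; closes no socket; does NOT touch the closer).
THE MATHEMATICS [BernsteinLapid2019, Thm 2.3, §2.1, §4 p. 10].  With EXACTLY the letters of ★ P8 §2 `sphericalEisenstein_meromorphicOn_ball_of_letters` MINUS the scalar data
(`i₀, hĥ₀, g, Λ, hΛ`), the packaged `𝔛`-system `A z (ψ, b) = c z` of ★ G-c is `g`-free, and ★ `exists_solution_byproducts` (Thm 2.3 with its holomorphy set kept) gives `v = (vX, cc)`
holomorphic on an open dense CO-DISCRETE `U ⊆ ball 0 (n+2)`, THE solution there, equal to the Eisenstein data `(eX, bX)` on `U ∩ {1 < re}`: this is (E2) (local `𝓗_k`-boundedness =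
continuity of `vX` on `U`) and (E3) (the continued constant-term coefficient `cc`, holomorphic on `U`, with `cnstN (ι (vX z)) = φ₀•α₁ z + cc z•α₂ z` on `U` and `cc = bX` on
`U ∩ {1 < re}`).  For (E1): for every point-value function `E` and functionals `Λ_i ∈ 𝓗_k'` with `Λ_i (eX z) = ĥ_i(z)·E z` on the Godement part (★ P3-D `exists_evalCLM` ∘ ★ ℓ9, one per
test function), the scalar piece `Ec` (★ G-a scalarisation through an index `j₀` with `ĥ_{j₀}(0) ≠ 0`) is meromorphic on the ball, `= E` on its Godement part, and near every `z ∈ U` with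
`ĥ_j(z) ≠ 0` it is EVENTUALLY `ĥ_j⁻¹·Λ_j(vX ·)` (identity principle in normal form on the convex ball, ★ G-a `toMeromorphicNFOn_eqOn_of_eventuallyEq`) — hence of NON-NEGATIVE ORDER on
`U` (`hcov`), the input `hord` of ★ `exists_global_pole_set`.
* **`exists_xSystem_byproducts`** — all of the above in one `∃ U vX cc` statement (so that (E1)–(E3) refer to the SAME `U`).
HONEST LABEL.  Count-neutral helper; closes no socket; HC_CM is proved only modulo the 7 printed citations (2 remaining named inputs: hLiu418 = `stmt-HodgeConjecture-24832`, h413 =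
`stmt-HodgeConjecture-24833`) until rung 0 closes.  References: [BernsteinLapid2019] J. Bernstein, E. Lapid, *On the meromorphic continuation of Eisenstein series*, JAMS 37 (2024)
(arXiv:1911.02342), Thm 2.3, §2.1, §4 p. 10; [ReedSimonI1980] M. Reed, B. Simon, *Methods of Modern Mathematical Physics I*, Thm. VI.14.
-/

set_option autoImplicit false
-- the mandated namespace repeats `HodgeConjecture.HodgeConjecture`, as in every `Theorems/*.lean` of this sub-problem
set_option linter.dupNamespace false

noncomputable section

open MeasureTheory Filter Topology Set Submodule NumberField
open scoped NNReal ENNReal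
open Literature.NumberTheory.Automorphic Literature.NumberTheory.Automorphic.UnitaryGroup AdelicGroupData
open Summit.HodgeConjecture.HodgeConjecture.Cruxes.H413.K2E1BorelEisensteinU
open Summit.HodgeConjecture.HodgeConjecture.Cruxes.H413.K2E1BLBorelSpacesU2Defs
open Summit.HodgeConjecture.HodgeConjecture.Cruxes.H413.K2E1BLBorelOperatorsU2Defs
open Summit.HodgeConjecture.HodgeConjecture.Cruxes.H413.K2E1BLMeromorphicGluing (meromorphicOn_scalarisation toMeromorphicNFOn_eqOn_of_eventuallyEq)
open Summit.HodgeConjecture.HodgeConjecture.Cruxes.H413.K2E1MeromorphicSolutionPrincipleLocal (eventually_ne_zero_of_analyticOnNhd exists_mem_ne_zero_of_isOpen)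
open Summit.HodgeConjecture.HodgeConjecture.Cruxes.H413.K2E1BLXSystemPackage (exists_xSystem xSystem_existsUnique_of)
open Summit.HodgeConjecture.HodgeConjecture.Cruxes.H413.K2E1BLHeightPowerHolomorphicU2 (differentiableOn_HN_of_ae_eq_cpow_self differentiableOn_HN_of_ae_eq_cpow_one_sub)
open Summit.HodgeConjecture.HodgeConjecture.Cruxes.H413.K2E1SphericalHeckeEigenSectionU2 (differentiable_integral_mul_borelHeight_cpow)
open Summit.HodgeConjecture.HodgeConjecture.Cruxes.H413.K2E1SphericalEisensteinMeromorphicBallU2 (piN_comp_restrHN_comp_iota isCompactOperator_deltaShift_comp_one_sub_cnstN)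
open Summit.HodgeConjecture.HodgeConjecture.Cruxes.H413.K2E1BLMeromorphicFamilyByproductsU (exists_solution_byproducts)

namespace Summit.HodgeConjecture.HodgeConjecture.Cruxes.H413.K2E1BLXSystemByproductsU

variable {F E : Type} [Field F] [NumberField F] [Field E] [NumberField E] [Algebra F E] {c : E ≃ₐ[F] E} {N : ℕ} [NeZero N]
variable [MeasurableSpace (quasiSplit F E c N).Adelic] [BorelSpace (quasiSplit F E c N).Adelic]

/-- **THE BY-PRODUCTS OF BERNSTEIN–LAPID ON ONE BALL** (rank `N`; letters = ★ P8 §2 `…_ball_of_letters` minus `i₀, hĥ₀, g, Λ, hΛ`).  `∃ U vX cc`: `U ⊆ ball 0 (n+2)` open, dense and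
CO-DISCRETE in the ball; `vX : ℂ → 𝓗_k(𝔛)`, `cc : ℂ → ℂ` holomorphic on `U` (`vX` meromorphic on the ball); on `U` the three equations `T_i(vX z) = ĥ_i(z)•vX z`,
`cnstN (ι (vX z)) = φ₀•α₁ z + cc z•α₂ z`, `Q (vX z) = 0` hold and characterise `(vX z, cc z)`; `(vX, cc) = (eX, bX)` on `U ∩ {1 < re}`; and for every `E : ℂ → ℂ` and functionals `Λ_i`
with `Λ_i (eX z) = ĥ_i(z)·E z` on the Godement part of the ball there is a scalar piece `Ec`, meromorphic on the ball, `= E` on its Godement part, eventually `= ĥ_j⁻¹·Λ_j(vX ·)` near every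
`z ∈ U` with `ĥ_j(z) ≠ 0`, hence of non-negative order at every point of `U`. [cite: BernsteinLapid2019, Thm 2.3, §2.1 and §4 p. 10] [cite: ReedSimonI1980, Thm. VI.14] -/
theorem exists_xSystem_byproducts (n k : ℕ) (hk : (n : ℝ) + 3 ≤ k) {μ : Measure (quasiSplit F E c N).automorphicQuotient}
    {μZ : Measure (borelQuotient F E c N)} (νG : Measure (quasiSplit F E c N).Adelic) [IsFiniteMeasureOnCompacts νG]
    -- levels and the ι-package
    {I : Type} [Fintype I] {a : ℝ≥0} (ha : 0 < a) {a₀ : I → ℝ≥0} (haa₀ : ∀ i, a ≤ a₀ i) (hfin : μZ {z | a < borelQuotHeight F E c N z} ≠ ∞)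
    [hfin₀ : ∀ i, IsFiniteMeasure (weightedTruncMeasure F E c N k (a₀ i) μZ)] (hb : IotaBound F E c N k a μ μZ) (hb₀ : ∀ i, IotaBound F E c N k (a₀ i) μ μZ)
    (hcl₀ : ∀ i, IsClosed ((LinearMap.range (iota (hb₀ i)).toLinearMap : Submodule ℂ (HN F E c N k (a₀ i) μZ)) : Set (HN F E c N k (a₀ i) μZ)))
    (hinj₀ : ∀ i, Function.Injective (iota (hb₀ i)))
    -- the good test functions and their transforms
    (h : I → (quasiSplit F E c N).Adelic → ℂ) (hhc : ∀ i, Continuous (h i)) (hhs : ∀ i, HasCompactSupport (h i))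
    (hcov : ∀ z ∈ Metric.ball (0 : ℂ) (n + 2), ∃ i, (∫ x, h i x * (((borelHeight x : ℝ≥0) : ℝ) : ℂ) ^ z ∂νG) ≠ 0)
    -- the `Z`-side Hecke operators (★ `ShiftBound`) and K2's decay letters
    (hs : ∀ i, ShiftBound F E c N k a (a₀ i) νG μZ (h i)) {m C : I → ℝ} (hm : ∀ i, 0 ≤ m i) (hC : ∀ i, 0 ≤ C i)
    (hK1 : ∀ i, ∀ f : HNcusp F E c N k a μZ, ∀ᵐ z ∂(weightedTruncMeasure F E c N k (a₀ i) μZ),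
      ‖rightConvFun F E c N νG (h i) ((f : HN F E c N k a μZ) : borelQuotient F E c N → ℂ) z‖ ≤ C i * ‖f‖ * ((borelQuotHeight F E c N z : ℝ)) ^ (-m i))
    -- the `𝔛`-side Hecke operators and the intertwining (P3-C)
    (T : I → HX F E c N k μ →L[ℂ] HX F E c N k μ) (hδι : ∀ i, deltaShift (hs i) ∘L iota hb = restrHN F E c N k (haa₀ i) μZ ∘L iota hb ∘L T i)
    -- the constant-term vectors and the cusp-orthogonality operator
    {α₁ α₂ : ℂ → HN F E c N k a μZ}
    (hα₁ : ∀ z ∈ Metric.ball (0 : ℂ) (n + 2), (α₁ z : borelQuotient F E c N → ℂ) =ᵐ[weightedTruncMeasure F E c N k a μZ] fun x => (((borelQuotHeight F E c N x : ℝ≥0) : ℝ) : ℂ) ^ z)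
    (hα₂ : ∀ z ∈ Metric.ball (0 : ℂ) (n + 2), (α₂ z : borelQuotient F E c N → ℂ) =ᵐ[weightedTruncMeasure F E c N k a μZ] fun x => (((borelQuotHeight F E c N x : ℝ≥0) : ℝ) : ℂ) ^ (1 - z))
    (hα₂ne : ∀ z ∈ Metric.ball (0 : ℂ) (n + 2), α₂ z ≠ 0) {X' : Type} [NormedAddCommGroup X'] [NormedSpace ℂ X'] [CompleteSpace X'] (Q : HX F E c N k μ →L[ℂ] X') (φ₀ : ℂ)
    -- the Eisenstein data in `𝓗_k(𝔛)` on the Godement set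
    (eX : ℂ → HX F E c N k μ) (bX : ℂ → ℂ)
    (hsolT : ∀ z ∈ Metric.ball (0 : ℂ) (n + 2), 1 < z.re → ∀ i, T i (eX z) = (∫ x, h i x * (((borelHeight x : ℝ≥0) : ℝ) : ℂ) ^ z ∂νG) • eX z)
    (hsolC : ∀ z ∈ Metric.ball (0 : ℂ) (n + 2), 1 < z.re → cnstN F E c N k a μZ (iota hb (eX z)) = φ₀ • α₁ z + bX z • α₂ z)
    (hsolQ : ∀ z ∈ Metric.ball (0 : ℂ) (n + 2), 1 < z.re → Q (eX z) = 0)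
    -- uniqueness of the `ψ`-component on an open non-empty part of the Godement set (P6′)
    (hunq : ∃ U₀ : Set ℂ, IsOpen U₀ ∧ U₀.Nonempty ∧ U₀ ⊆ Metric.ball (0 : ℂ) (n + 2) ∩ {z : ℂ | 1 < z.re} ∧
      ∀ z ∈ U₀, ∀ (ψ : HX F E c N k μ) (b : ℂ), (∀ i, T i ψ = (∫ x, h i x * (((borelHeight x : ℝ≥0) : ℝ) : ℂ) ^ z ∂νG) • ψ) →
        cnstN F E c N k a μZ (iota hb ψ) = φ₀ • α₁ z + b • α₂ z → Q ψ = 0 → ψ = eX z) :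
    ∃ (U : Set ℂ) (vX : ℂ → HX F E c N k μ) (cc : ℂ → ℂ),
      IsOpen U ∧ U ⊆ Metric.ball (0 : ℂ) (n + 2) ∧ Metric.ball (0 : ℂ) (n + 2) ⊆ closure U ∧ (∀ z₀ ∈ Metric.ball (0 : ℂ) (n + 2), ∀ᶠ s in 𝓝[≠] z₀, s ∈ U) ∧
      DifferentiableOn ℂ vX U ∧ MeromorphicOn vX (Metric.ball (0 : ℂ) (n + 2)) ∧ DifferentiableOn ℂ cc U ∧
      (∀ z ∈ U, (∀ i, T i (vX z) = (∫ x, h i x * (((borelHeight x : ℝ≥0) : ℝ) : ℂ) ^ z ∂νG) • vX z) ∧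
        cnstN F E c N k a μZ (iota hb (vX z)) = φ₀ • α₁ z + cc z • α₂ z ∧ Q (vX z) = 0) ∧
      (∀ z ∈ U, ∀ (ψ : HX F E c N k μ) (b : ℂ), (∀ i, T i ψ = (∫ x, h i x * (((borelHeight x : ℝ≥0) : ℝ) : ℂ) ^ z ∂νG) • ψ) →
        cnstN F E c N k a μZ (iota hb ψ) = φ₀ • α₁ z + b • α₂ z → Q ψ = 0 → ψ = vX z ∧ b = cc z) ∧
      (∀ z ∈ U, 1 < z.re → vX z = eX z ∧ cc z = bX z) ∧
      ∀ (Es : ℂ → ℂ) (Λ : I → HX F E c N k μ →L[ℂ] ℂ),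
        (∀ i, ∀ z ∈ Metric.ball (0 : ℂ) (n + 2), 1 < z.re → Λ i (eX z) = (∫ x, h i x * (((borelHeight x : ℝ≥0) : ℝ) : ℂ) ^ z ∂νG) * Es z) →
        ∃ Ec : ℂ → ℂ, MeromorphicOn Ec (Metric.ball (0 : ℂ) (n + 2)) ∧ (∀ z ∈ Metric.ball (0 : ℂ) (n + 2), 1 < z.re → Ec z = Es z) ∧
          (∀ j, ∀ z ∈ U, (∫ x, h j x * (((borelHeight x : ℝ≥0) : ℝ) : ℂ) ^ z ∂νG) ≠ 0 →
            Ec =ᶠ[𝓝[≠] z] fun s => (∫ x, h j x * (((borelHeight x : ℝ≥0) : ℝ) : ℂ) ^ s ∂νG)⁻¹ * Λ j (vX s)) ∧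
          ∀ z ∈ U, 0 ≤ meromorphicOrderAt Ec z := by
  -- abbreviations
  set D : Set ℂ := Metric.ball (0 : ℂ) (n + 2) with hDdef
  set O : Set ℂ := {z : ℂ | 1 < z.re} with hOdef
  set ĥ : I → ℂ → ℂ := fun i z => ∫ x, h i x * (((borelHeight x : ℝ≥0) : ℝ) : ℂ) ^ z ∂νG with hĥdef
  have hD : IsOpen D := Metric.isOpen_ball
  have hDc : IsPreconnected D := (convex_ball (0 : ℂ) _).isPreconnected
  have hO : IsOpen O := isOpen_lt continuous_const Complex.continuous_re
  have hre : ∀ z ∈ D, |z.re| < n + 2 := fun z hz =>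
    lt_of_le_of_lt (Complex.abs_re_le_norm z) (by rwa [hDdef, Metric.mem_ball, dist_zero_right] at hz)
  -- holomorphy of the transforms and of `α₁`, `α₂` (verbatim ★ P8 §2)
  have hĥd : ∀ i, DifferentiableOn ℂ (ĥ i) D := fun i => (differentiable_integral_mul_borelHeight_cpow νG (hhc i) (hhs i)).differentiableOn
  have hĥa : ∀ i, AnalyticOnNhd ℂ (ĥ i) D := fun i => (hĥd i).analyticOnNhd hD
  have hα₁d : DifferentiableOn ℂ α₁ D :=
    differentiableOn_HN_of_ae_eq_cpow_self (σ₀ := -((n : ℝ) + 2)) (σ₁ := (n : ℝ) + 2) ha hfin (by linarith) (by linarith) hD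
      (fun z hz => ⟨by linarith [(abs_lt.1 (hre z hz)).1], by linarith [(abs_lt.1 (hre z hz)).2]⟩) hα₁
  have hα₂d : DifferentiableOn ℂ α₂ D :=
    differentiableOn_HN_of_ae_eq_cpow_one_sub (σ₀ := -((n : ℝ) + 1)) (σ₁ := (n : ℝ) + 3) ha hfin (by linarith) (by linarith) hD
      (fun z hz => ⟨by linarith [(abs_lt.1 (hre z hz)).2], by linarith [(abs_lt.1 (hre z hz)).1]⟩) hα₂
  -- the packaged `𝔛`-system (★ G-c) — `g`-free
  haveI : CompleteSpace ((I → HX F E c N k μ) × (HN F E c N k a μZ × X')) := inferInstance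
  obtain ⟨A, c𝓦, hA, hc𝓦, hchar, hfinT⟩ := exists_xSystem (V₀ := fun i => HN F E c N k (a₀ i) μZ) hD T hĥd hcov (iota hb) (cnstN F E c N k a μZ) Q hα₁d hα₂d φ₀
    (fun i => deltaShift (hs i)) (fun i => restrHN F E c N k (haa₀ i) μZ) (fun i => piN (hb₀ i) (hcl₀ i) (hinj₀ i)) hδι
    (fun i => piN_comp_restrHN_comp_iota (haa₀ i) hb (hb₀ i) (hcl₀ i) (hinj₀ i))
    (fun i => isCompactOperator_deltaShift_comp_one_sub_cnstN (lt_of_lt_of_le ha (haa₀ i)) (hs i) (hm i) (hC i) (hK1 i))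
  -- existence on the Godement set, uniqueness on `U₀`
  have hsol : ∀ z ∈ D ∩ O, A z ((fun z => (eX z, bX z)) z) = c𝓦 z := fun z hz =>
    (hchar z (eX z) (bX z)).2 ⟨hsolT z hz.1 hz.2, hsolC z hz.1 hz.2, hsolQ z hz.1 hz.2⟩
  obtain ⟨U₀, hU₀o, hU₀ne, hU₀D, hU₀unq⟩ := hunq
  have hunq' : ∃ U₀ : Set ℂ, IsOpen U₀ ∧ U₀.Nonempty ∧ U₀ ⊆ D ∩ O ∧ ∀ z ∈ U₀, ∀ w : HX F E c N k μ × ℂ, A z w = c𝓦 z → w = (fun z => (eX z, bX z)) z := by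
    refine ⟨U₀, hU₀o, hU₀ne, hU₀D, fun z hz w hw => ?_⟩
    have hex : ∃! x : HX F E c N k μ × ℂ, A z x = c𝓦 z :=
      xSystem_existsUnique_of hchar (hα₂ne z (hU₀D hz).1) (hsol z (hU₀D hz)) fun ψ b hψb =>
        hU₀unq z hz ψ b ((hchar z ψ b).1 hψb).1 ((hchar z ψ b).1 hψb).2.1 ((hchar z ψ b).1 hψb).2.2
    exact hex.unique hw (hsol z (hU₀D hz))
  -- Thm 2.3 with the holomorphy set kept
  obtain ⟨v, U, hUo, hUD, hcl, hUcd, hvU, hvmer, hsolU, hve⟩ := exists_solution_byproducts hD hDc hA hc𝓦 hfinT hsol hunq'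
  -- the components
  have hfst : ∀ z, (v z).1 = (ContinuousLinearMap.fst ℂ (HX F E c N k μ) ℂ) (v z) := fun z => rfl
  have hsnd : ∀ z, (v z).2 = (ContinuousLinearMap.snd ℂ (HX F E c N k μ) ℂ) (v z) := fun z => rfl
  have hvXd : DifferentiableOn ℂ (fun z => (v z).1) U := (ContinuousLinearMap.fst ℂ (HX F E c N k μ) ℂ).differentiable.comp_differentiableOn hvU
  have hccd : DifferentiableOn ℂ (fun z => (v z).2) U := (ContinuousLinearMap.snd ℂ (HX F E c N k μ) ℂ).differentiable.comp_differentiableOn hvU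
  have hvXm : MeromorphicOn (fun z => (v z).1) D := fun z hz => (ContinuousLinearMap.fst ℂ (HX F E c N k μ) ℂ).comp_meromorphicAt (hvmer z hz)
  -- the equations on `U` and uniqueness there
  have hsolv : ∀ z ∈ U, A z (v z) = c𝓦 z := fun z hz => (hsolU z hz (v z)).2 rfl
  have heqs : ∀ z ∈ U, (∀ i, T i (v z).1 = ĥ i z • (v z).1) ∧ cnstN F E c N k a μZ (iota hb (v z).1) = φ₀ • α₁ z + (v z).2 • α₂ z ∧ Q (v z).1 = 0 :=
    fun z hz => (hchar z (v z).1 (v z).2).1 (hsolv z hz)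
  refine ⟨U, fun z => (v z).1, fun z => (v z).2, hUo, hUD, hcl, hUcd, hvXd, hvXm, hccd, heqs, fun z hz ψ b h1 h2 h3 => ?_, fun z hz hz1 => ?_, fun Es Λ hΛ => ?_⟩
  · have hw : (ψ, b) = v z := (hsolU z hz (ψ, b)).1 ((hchar z ψ b).2 ⟨h1, h2, h3⟩)
    exact ⟨congrArg Prod.fst hw, congrArg Prod.snd hw⟩
  · have hw : v z = (eX z, bX z) := hve z ⟨hz, hz1⟩
    exact ⟨congrArg Prod.fst hw, congrArg Prod.snd hw⟩
  -- the scalar piece: scalarise through an index `j₀` with `ĥ_{j₀}(0) ≠ 0`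
  have h0D : (0 : ℂ) ∈ D := by rw [hDdef]; exact Metric.mem_ball_self (by positivity)
  obtain ⟨j₀, hj₀⟩ := hcov 0 h0D
  have hĥc : ∀ j, Continuous (ĥ j) := fun j => (differentiable_integral_mul_borelHeight_cpow νG (hhc j) (hhs j)).continuous
  have hvXU : ∀ s ∈ U, 1 < s.re → (v s).1 = eX s := fun s hs hs1 => congrArg Prod.fst (hve s ⟨hs, hs1⟩)
  -- the local analytic germs `g_j := ĥ_j⁻¹ · Λ_j ∘ vX`, analytic on `U ∩ {ĥ_j ≠ 0}`, `= Es` on `U ∩ O` there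
  have hgerm : ∀ j, ∀ z ∈ U, ĥ j z ≠ 0 → AnalyticAt ℂ (fun s => (ĥ j s)⁻¹ * Λ j (v s).1) z := by
    intro j z hz hjz
    have hva : AnalyticAt ℂ v z := hvU.analyticAt (hUo.mem_nhds hz)
    have h2 : AnalyticAt ℂ (fun s => Λ j (v s).1) z := ((Λ j ∘L ContinuousLinearMap.fst ℂ (HX F E c N k μ) ℂ).analyticAt (v z)).comp hva
    exact ((hĥa j z (hUD hz)).inv hjz).mul h2
  have hEq : ∀ j, ∀ s ∈ U, s ∈ D → 1 < s.re → ĥ j s ≠ 0 → (ĥ j s)⁻¹ * Λ j (v s).1 = Es s := by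
    intro j s hsU hsD hs1 hjs
    rw [hvXU s hsU hs1, hΛ j s hsD hs1, inv_mul_cancel_left₀ hjs]
  -- the scalarisations `S j`, meromorphic on `D` as soon as `ĥ_j ≢ 0`
  have hSmer : ∀ j, ∀ z₁ ∈ D, ĥ j z₁ ≠ 0 → MeromorphicOn (fun z => if z ∈ O then Es z else (ĥ j z)⁻¹ * Λ j (v z).1) D := by
    intro j z₁ hz₁ hjz₁
    refine meromorphicOn_scalarisation hvXm (Λ j) (hĥa j).meromorphicOn Es fun z₀ hz₀ => ?_
    filter_upwards [hUcd z₀ hz₀, eventually_ne_zero_of_analyticOnNhd hDc (hĥa j) hz₁ hjz₁ hz₀, mem_nhdsWithin_of_mem_nhds (hD.mem_nhds hz₀)] with s hsU hĥs hsD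
    intro hsO
    exact ⟨hĥs, by rw [hvXU s hsU hsO, hΛ j s hsD hsO]⟩
  -- near a point of `U` where `ĥ_j ≠ 0`, every `S j'` (with `ĥ_{j'} ≢ 0`) is eventually the germ `g_j`
  have hloc : ∀ j', ∀ z₁' ∈ D, ĥ j' z₁' ≠ 0 → ∀ j, ∀ z ∈ U, ĥ j z ≠ 0 →
      (fun z => if z ∈ O then Es z else (ĥ j' z)⁻¹ * Λ j' (v z).1) =ᶠ[𝓝[≠] z] fun s => (ĥ j s)⁻¹ * Λ j (v s).1 := by
    intro j' z₁' hz₁' hj'z₁' j z hz hjz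
    -- a base point `z₁ ∈ U ∩ (D ∩ O)` with `ĥ_j(z₁) ≠ 0`
    have hx : ((3 / 2 : ℝ) : ℂ) ∈ D ∩ O := by
      refine ⟨?_, ?_⟩
      · rw [hDdef, Metric.mem_ball, dist_zero_right, Complex.norm_real, Real.norm_eq_abs, abs_of_pos (by norm_num)]
        have : (0 : ℝ) ≤ n := Nat.cast_nonneg n
        linarith
      · show (1 : ℝ) < ((3 / 2 : ℝ) : ℂ).re
        rw [Complex.ofReal_re]; norm_num
    have hVo : IsOpen ((D ∩ O) ∩ U) := (hD.inter hO).inter hUo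
    have hVne : ((D ∩ O) ∩ U).Nonempty := mem_closure_iff_nhds.1 (hcl hx.1) _ ((hD.inter hO).mem_nhds hx)
    obtain ⟨z₁, hz₁V, hjz₁⟩ := exists_mem_ne_zero_of_isOpen hDc (hĥa j) (hUD hz) hjz hVo (fun s hs => hs.1.1) hVne
    -- both pieces equal `Es` near `z₁`, and the germ `g_j` equals `Es` there too
    have hWo : IsOpen (((D ∩ O) ∩ U) ∩ {s | ĥ j s ≠ 0}) := hVo.inter (isOpen_ne_fun (hĥc j) continuous_const)
    have hW1 : ((D ∩ O) ∩ U) ∩ {s | ĥ j s ≠ 0} ∈ 𝓝 z₁ := hWo.mem_nhds ⟨hz₁V, hjz₁⟩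
    have hgerm₁ : AnalyticAt ℂ (fun s => (ĥ j s)⁻¹ * Λ j (v s).1) z₁ := hgerm j z₁ hz₁V.2 hjz₁
    have hf : (fun z => if z ∈ O then Es z else (ĥ j' z)⁻¹ * Λ j' (v z).1) =ᶠ[𝓝 z₁] fun s => (ĥ j s)⁻¹ * Λ j (v s).1 := by
      filter_upwards [hW1] with s hs
      rw [if_pos hs.1.1.2, hEq j s hs.1.2 hs.1.1.1 hs.1.1.2 hs.2]
    have hf' : (fun z => if z ∈ O then Es z else (ĥ j z)⁻¹ * Λ j (v z).1) =ᶠ[𝓝 z₁] fun s => (ĥ j s)⁻¹ * Λ j (v s).1 := by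
      filter_upwards [hW1] with s hs
      rw [if_pos hs.1.1.2, hEq j s hs.1.2 hs.1.1.1 hs.1.1.2 hs.2]
    have hNF := toMeromorphicNFOn_eqOn_of_eventuallyEq (subset_refl D) hDc (hSmer j' z₁' hz₁' hj'z₁') (hSmer j z (hUD hz) hjz) hz₁V.1.1 hgerm₁ hf hf'
    -- near `z`: `S j' = NF(S j') = NF(S j) = S j = g_j`
    have h1 : (fun z => if z ∈ O then Es z else (ĥ j' z)⁻¹ * Λ j' (v z).1) =ᶠ[𝓝[≠] z]
        toMeromorphicNFOn (fun z => if z ∈ O then Es z else (ĥ j' z)⁻¹ * Λ j' (v z).1) D :=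
      ((hSmer j' z₁' hz₁' hj'z₁').toMeromorphicNFOn_eq_self_on_nhdsNE (hUD hz)).symm
    have h2 : toMeromorphicNFOn (fun z => if z ∈ O then Es z else (ĥ j' z)⁻¹ * Λ j' (v z).1) D =ᶠ[𝓝[≠] z]
        toMeromorphicNFOn (fun z => if z ∈ O then Es z else (ĥ j z)⁻¹ * Λ j (v z).1) D :=
      (eventually_of_mem (hD.mem_nhds (hUD hz)) hNF).filter_mono nhdsWithin_le_nhds
    have h3 : toMeromorphicNFOn (fun z => if z ∈ O then Es z else (ĥ j z)⁻¹ * Λ j (v z).1) D =ᶠ[𝓝[≠] z]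
        (fun z => if z ∈ O then Es z else (ĥ j z)⁻¹ * Λ j (v z).1) :=
      (hSmer j z (hUD hz) hjz).toMeromorphicNFOn_eq_self_on_nhdsNE (hUD hz)
    have h4 : (fun z => if z ∈ O then Es z else (ĥ j z)⁻¹ * Λ j (v z).1) =ᶠ[𝓝[≠] z] fun s => (ĥ j s)⁻¹ * Λ j (v s).1 := by
      refine (eventually_of_mem ((hUo.inter ((isOpen_ne_fun (hĥc j) continuous_const).inter hD)).mem_nhds ⟨hz, hjz, hUD hz⟩) fun s hs => ?_).filter_mono
        nhdsWithin_le_nhds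
      show (if s ∈ O then Es s else (ĥ j s)⁻¹ * Λ j (v s).1) = (ĥ j s)⁻¹ * Λ j (v s).1
      by_cases hsO : s ∈ O
      · rw [if_pos hsO, hEq j s hs.1 hs.2.2 hsO hs.2.1]
      · rw [if_neg hsO]
    exact ((h1.trans h2).trans h3).trans h4
  refine ⟨fun z => if z ∈ O then Es z else (ĥ j₀ z)⁻¹ * Λ j₀ (v z).1, hSmer j₀ 0 h0D hj₀, fun z _ hz1 => by simp only [if_pos (show z ∈ O from hz1)],
    fun j z hz hjz => hloc j₀ 0 h0D hj₀ j z hz hjz, fun z hz => ?_⟩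
  obtain ⟨j, hjz⟩ := hcov z (hUD hz)
  rw [meromorphicOrderAt_congr (hloc j₀ 0 h0D hj₀ j z hz hjz)]
  exact (hgerm j z hz hjz).meromorphicOrderAt_nonneg

end Summit.HodgeConjecture.HodgeConjecture.Cruxes.H413.K2E1BLXSystemByproductsU

end
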